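import Summits.NavierStokesRegularity.FluidComputer.PalasekTowerLundgrenChildLaws
import Literature.Analysis.FluidPDE.PlanarVelocityDecay

/-!
# REGISTER v2.3″ (continued): the swirl-speed CEILING of a Lundgren-carried child core of arbitrary
# cross-section — `‖swirl(t)‖_∞ ≤ K Γ (λA_k/(1 − e^{−λA_k t}))^{1/2}`, uniform in time

Cell `ns-blowup`, seat `ns-blowup-ecbridge-8` (g6); evidence toward the UPPER half of crux 19250
`HeredityFromTwo` (`stub_apriori_ceiling` / `WindowCeilingAt`) of route `PalasekTowerBreakdown`, in
the MODEL lane. Companion of `PalasekTowerLundgrenChildLaws` and `PalasekTowerLundgrenChildSwirlFloor`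
(same MODEL IDENTIFICATION «child core = cross-section of Lundgren's stretched flow in the host strain
`c = λA_k` at `ν = 1`», same hypotheses). It reads the Literature theorem
`Lundgren.norm_swirl_lundgren_const_le_of_circulation` (ecbridge-8 g6: Gallay–Wayne's `L⁴`
smoothing of the planar vorticity by Nash's argument, `PlanarVorticityLpDecay`, + Gallay–Wayne 2002
Lemma 2.1 (b), `BiotSavart2DSupInterpolation`, through Saffman §13.3 (29)) in register units.

* `palasekTowerBreakdown_childSwirl_le_of_circulation_anyProfile` — for a co-signed child
  (`ω_z(0, ·) ≥ 0`) of circulation `Γ` carried by the host strain `λA_k`, at every time `t > 0` of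
  the window and every point: **`‖swirl(t, y)‖ ≤ K Γ (λA_k/(1 − e^{−λA_k t}))^{1/2}`**,
  `K = (2π)⁻¹((3π)^{3/4}((128/3) C_GNS³)^{1/4} + 1)` (`C_GNS` Mathlib's planar
  Gagliardo–Nirenberg–Sobolev constant) — NO dependence on the initial peak, NO growth with the
  stretch (contrast `_childSwirl_le_sqrtStretch_anyProfile`: `≤ e^{λA_k t/2}·2(BΓ/2π)^{1/2}`).
* `palasekTowerBreakdown_childSwirl_le_after_one_strain_time_anyProfile` — after ONE strain time
  (`λA_k t ≥ 1`): **`‖swirl(t, y)‖ ≤ (63/50) K Γ (λA_k)^{1/2}`** (`(1 − e^{−1})^{−1/2} < 63/50`,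
  certified from `Real.exp_neg_one_lt_d9`).
* (v2) `palasekTowerBreakdown_childPeak_le_of_circulation_anyProfile` — the PEAK AXIAL VORTICITY:
  **`0 ≤ ω_z(t, x) ≤ 8 C_GNS Γ λA_k/(1 − e^{−λA_k t})`** for `t > 0` (the `L^∞` endpoint of the
  Nash–Moser iteration, `PlanarVorticityLpDecay` §6, through Saffman (29));
  `…_childPeak_le_after_one_strain_time_anyProfile`: `≤ 8 (63/50)² C_GNS Γ λA_k` once `λA_k t ≥ 1` —
  the companion of the peak FLOOR `Γ λA_k/(8πρ)` (`_childPeak_floor_of_budget_anyProfile`).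

Reading (numbers, not adjectives): the child's swirl speed is two-sidedly pinned at the Burgers scale
`Γ (λA_k)^{1/2}` within `O(1/(λA_k))` of the hand-over — ceiling `(63/50)K` after one strain time
(this file), floor `(8π)⁻¹ρ^{−1/2}` after the N-2′ budget (`_childSwirl_floor_of_budget_anyProfile`);
the window lasts `A_k(τ_{k+1} − τ_k) ≈ 61.7–75` strain times (LEAD-READING-19250-v3 col. 11). The
constant `K` is explicit but not numerically certified (Mathlib's `C_GNS` is not evaluated).

WHAT THIS IS NOT: not NS about any registered flow — exact INFINITE-ENERGY Lundgren flows, no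
registered stage; nothing is asserted about `AprioriCeiling`, `WindowCeilingAt`, `ReadoutFloors` or
any crux; the identification «child core = Lundgren cross-section» is a MODEL step.

References: Th. Gallay, C. E. Wayne, Comm. Math. Phys. 255 (2005), Thm. 1.1 (1.2)
[cite: GallayWayne2005, Thm. 1.1 eq. (1.2)]; Arch. Ration. Mech. Anal. 163 (2002), Lemma 2.1 (b)
[cite: GallayWayne2002, Lemma 2.1 (b)]; P. G. Saffman, *Vortex Dynamics*, CUP 1992, §13.3 (26)–(31)
[cite: Saffman1992, §13.3 eqs. (26)–(31)]; S. Palasek, arXiv:2605.13827, §3 (3.2)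
[cite: Palasek2026ElementaryModel, §3 (3.2)].
-/

namespace Summit.NavierStokesRegularity.FluidComputer.PalasekTowerClayBridge

open Real Set MeasureTheory
open Literature.Analysis.FluidPDE Literature.Analysis.FluidPDE.Lundgren

variable {S S' : Set ℝ}
  {v : ℝ → EuclideanSpace ℝ (Fin 2) → EuclideanSpace ℝ (Fin 2)}
  {q : ℝ → EuclideanSpace ℝ (Fin 2) → ℝ} {w : ℝ → EuclideanSpace ℝ (Fin 2) → ℝ}

/-- **THE CHILD'S SWIRL-SPEED CEILING, FOR ANY PROFILE, UNIFORM IN TIME** (`ν = 1`, host strain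
`λA_k`; the setting of `_childSwirl_floor_of_budget_anyProfile` without budget or fatness
hypotheses): for a co-signed child (`ω_z(0, ·) ≥ 0` on `ℝ³`) with cross-section circulation
`Γ = ∫ ω_z(0, ιy + z₀e_z) dy`, at every later time `t > 0` of `S` and every `y`,
**`‖e^{ct/2} ṽ(T(t), e^{ct/2} y)‖ ≤ K Γ (λA_k/(1 − e^{−λA_k t}))^{1/2}`** (`c = λA_k`,
`T(t) = (e^{ct} − 1)/c`, `K = (2π)⁻¹((3π)^{3/4}((128/3)C_GNS³)^{1/4} + 1)`): the planar flow's
velocity decays like `K Γ (T − T₀)^{−1/2}` (Gallay–Wayne smoothing + Kelvin,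
`IsClassicalNSSolutionOn.norm_le_of_planarVorticity_nonneg_of_lt`) and the stretch `e^{ct/2}` against
the Lundgren clock gives exactly `(c/(1 − e^{−ct}))^{1/2}`
(`Lundgren.norm_swirl_lundgren_const_le_of_circulation`). -/
theorem palasekTowerBreakdown_childSwirl_le_of_circulation_anyProfile (R : TowerRates) (k : ℕ)
    {l : ℝ} (hl : 0 < l) (hS' : Convex ℝ S') (hv : IsClassicalNSSolutionOn S' 1 0 v q)
    (hω : HasUniformRapidDecayOn S' (fun σ η => PlanarEigenmode.vorticity (v σ) η))
    (hBS : ∀ σ ∈ S', ∀ η, v σ η = biotSavart2D (PlanarEigenmode.vorticity (v σ)) η)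
    (hw : IsSmoothSpaceTimeOn S' w)
    (hmaps : MapsTo (fun t => (exp (l * R.A k * t) - 1) / (l * R.A k)) S S') (h0 : (0 : ℝ) ∈ S)
    {t : ℝ} (ht : t ∈ S) (ht0 : 0 < t) (z₀ : ℝ)
    (hpos : ∀ x : EuclideanSpace ℝ (Fin 3), 0 ≤ curl (velocity (fun _ => l * R.A k)
          (fun t y => exp (l * R.A k * t / 2) •
            v ((exp (l * R.A k * t) - 1) / (l * R.A k)) (exp (l * R.A k * t / 2) • y))
          (fun t y => exp (-(l * R.A k * t)) •
            w ((exp (l * R.A k * t) - 1) / (l * R.A k)) (exp (l * R.A k * t / 2) • y)) 0) x 2)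
    (y : EuclideanSpace ℝ (Fin 2)) :
    ‖exp (l * R.A k * t / 2) • v ((exp (l * R.A k * t) - 1) / (l * R.A k)) (exp (l * R.A k * t / 2) • y)‖ ≤
      (2 * π)⁻¹ * ((3 * π) ^ (3 / 4 : ℝ) *
        (128 / 3 * (lintegralPowLePowLIntegralFDerivConst
          (volume : Measure (EuclideanSpace ℝ (Fin 2))) 2 : ℝ) ^ 3) ^ (1 / 4 : ℝ) + 1) *
        (∫ y' : EuclideanSpace ℝ (Fin 2), curl (velocity (fun _ => l * R.A k)
          (fun t y => exp (l * R.A k * t / 2) •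
            v ((exp (l * R.A k * t) - 1) / (l * R.A k)) (exp (l * R.A k * t / 2) • y))
          (fun t y => exp (-(l * R.A k * t)) •
            w ((exp (l * R.A k * t) - 1) / (l * R.A k)) (exp (l * R.A k * t / 2) • y)) 0)
          (embedXY y' + z₀ • eZ) 2) *
        Real.sqrt (l * R.A k / (1 - exp (-(l * R.A k * t)))) := by
  have hγ : 0 < l * R.A k := mul_pos hl (R.A_pos k)
  have h := norm_swirl_lundgren_const_le_of_circulation hγ hS' one_pos hv hω hBS hw hmaps h0 ht ht0
    hpos z₀ y
  simpa only [one_mul, sub_zero] using h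

/-- `(1 − e^{−x})⁻¹ ≤ (63/50)²` for `x ≥ 1` (`e^{−1} < 0.3678794412`). [folklore] -/
private theorem inv_one_sub_exp_neg_le {x : ℝ} (hx : 1 ≤ x) :
    (1 - exp (-x))⁻¹ ≤ (63 / 50) ^ 2 := by
  have h1 : exp (-x) ≤ exp (-1) := exp_le_exp.2 (by linarith)
  have h2 : exp (-1) < 0.3678794412 := exp_neg_one_lt_d9
  have hpos : 0 < 1 - exp (-x) := by linarith
  rw [inv_le_comm₀ hpos (by norm_num)]
  norm_num at h2 ⊢
  linarith

/-- **AFTER ONE STRAIN TIME THE CEILING IS `(63/50)·K·Γ·(λA_k)^{1/2}`** (`ν = 1`; setting of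
`_childSwirl_le_of_circulation_anyProfile`): for `λA_k t ≥ 1`,
`‖e^{ct/2} ṽ(T(t), e^{ct/2} y)‖ ≤ (63/50) K Γ (λA_k)^{1/2}` — the Burgers swirl scale `Γ(λA_k)^{1/2}`
up to `(63/50)K`, whatever the profile; the CEILING companion of
`_childSwirl_floor_of_budget_anyProfile` (`≥ (8π)⁻¹ρ^{−1/2}·Γ(λA_k)^{1/2}` after the N-2′ budget),
both reached within `O(1)` strain times of a window lasting `≈ 61.7–75` of them. -/
theorem palasekTowerBreakdown_childSwirl_le_after_one_strain_time_anyProfile (R : TowerRates)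
    (k : ℕ) {l : ℝ} (hl : 0 < l) (hS' : Convex ℝ S') (hv : IsClassicalNSSolutionOn S' 1 0 v q)
    (hω : HasUniformRapidDecayOn S' (fun σ η => PlanarEigenmode.vorticity (v σ) η))
    (hBS : ∀ σ ∈ S', ∀ η, v σ η = biotSavart2D (PlanarEigenmode.vorticity (v σ)) η)
    (hw : IsSmoothSpaceTimeOn S' w)
    (hmaps : MapsTo (fun t => (exp (l * R.A k * t) - 1) / (l * R.A k)) S S') (h0 : (0 : ℝ) ∈ S)
    {t : ℝ} (ht : t ∈ S) (hstrain : 1 ≤ l * R.A k * t) (z₀ : ℝ)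
    (hpos : ∀ x : EuclideanSpace ℝ (Fin 3), 0 ≤ curl (velocity (fun _ => l * R.A k)
          (fun t y => exp (l * R.A k * t / 2) •
            v ((exp (l * R.A k * t) - 1) / (l * R.A k)) (exp (l * R.A k * t / 2) • y))
          (fun t y => exp (-(l * R.A k * t)) •
            w ((exp (l * R.A k * t) - 1) / (l * R.A k)) (exp (l * R.A k * t / 2) • y)) 0) x 2)
    (y : EuclideanSpace ℝ (Fin 2)) :
    ‖exp (l * R.A k * t / 2) • v ((exp (l * R.A k * t) - 1) / (l * R.A k)) (exp (l * R.A k * t / 2) • y)‖ ≤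
      63 / 50 * ((2 * π)⁻¹ * ((3 * π) ^ (3 / 4 : ℝ) *
        (128 / 3 * (lintegralPowLePowLIntegralFDerivConst
          (volume : Measure (EuclideanSpace ℝ (Fin 2))) 2 : ℝ) ^ 3) ^ (1 / 4 : ℝ) + 1)) *
        (∫ y' : EuclideanSpace ℝ (Fin 2), curl (velocity (fun _ => l * R.A k)
          (fun t y => exp (l * R.A k * t / 2) •
            v ((exp (l * R.A k * t) - 1) / (l * R.A k)) (exp (l * R.A k * t / 2) • y))
          (fun t y => exp (-(l * R.A k * t)) •
            w ((exp (l * R.A k * t) - 1) / (l * R.A k)) (exp (l * R.A k * t / 2) • y)) 0)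
          (embedXY y' + z₀ • eZ) 2) *
        Real.sqrt (l * R.A k) := by
  have hγ : 0 < l * R.A k := mul_pos hl (R.A_pos k)
  have ht0 : 0 < t := by
    by_contra hle
    have : l * R.A k * t ≤ 0 := mul_nonpos_of_nonneg_of_nonpos hγ.le (not_lt.1 hle)
    linarith
  have h := palasekTowerBreakdown_childSwirl_le_of_circulation_anyProfile R k hl hS' hv hω hBS hw hmaps
    h0 ht ht0 z₀ hpos y
  refine h.trans ?_
  -- the circulation is non-negative (co-signed child), the constant is non-negative
  have hΓ0 : 0 ≤ ∫ y' : EuclideanSpace ℝ (Fin 2), curl (velocity (fun _ => l * R.A k)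
          (fun t y => exp (l * R.A k * t / 2) •
            v ((exp (l * R.A k * t) - 1) / (l * R.A k)) (exp (l * R.A k * t / 2) • y))
          (fun t y => exp (-(l * R.A k * t)) •
            w ((exp (l * R.A k * t) - 1) / (l * R.A k)) (exp (l * R.A k * t / 2) • y)) 0)
          (embedXY y' + z₀ • eZ) 2 := integral_nonneg fun y' => hpos _
  have hK0 : 0 ≤ (2 * π)⁻¹ * ((3 * π) ^ (3 / 4 : ℝ) *
        (128 / 3 * (lintegralPowLePowLIntegralFDerivConst
          (volume : Measure (EuclideanSpace ℝ (Fin 2))) 2 : ℝ) ^ 3) ^ (1 / 4 : ℝ) + 1) := by positivity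
  -- `(c/(1 − e^{−ct}))^{1/2} ≤ (63/50) c^{1/2}`
  have hsq : Real.sqrt (l * R.A k / (1 - exp (-(l * R.A k * t)))) ≤ 63 / 50 * Real.sqrt (l * R.A k) := by
    have hpos : 0 < 1 - exp (-(l * R.A k * t)) := by
      have : exp (-(l * R.A k * t)) < 1 := exp_lt_one_iff.2 (by linarith)
      linarith
    have hle : l * R.A k / (1 - exp (-(l * R.A k * t))) ≤ (63 / 50) ^ 2 * (l * R.A k) := by
      rw [div_eq_mul_inv, mul_comm ((63 / 50 : ℝ) ^ 2)]
      exact mul_le_mul_of_nonneg_left (inv_one_sub_exp_neg_le hstrain) hγ.le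
    calc Real.sqrt (l * R.A k / (1 - exp (-(l * R.A k * t))))
        ≤ Real.sqrt ((63 / 50) ^ 2 * (l * R.A k)) := Real.sqrt_le_sqrt hle
      _ = 63 / 50 * Real.sqrt (l * R.A k) := by
          rw [Real.sqrt_mul (by norm_num : (0 : ℝ) ≤ (63 / 50) ^ 2) (l * R.A k),
            Real.sqrt_sq (by norm_num : (0 : ℝ) ≤ 63 / 50)]
  calc _ ≤ (2 * π)⁻¹ * ((3 * π) ^ (3 / 4 : ℝ) *
        (128 / 3 * (lintegralPowLePowLIntegralFDerivConst
          (volume : Measure (EuclideanSpace ℝ (Fin 2))) 2 : ℝ) ^ 3) ^ (1 / 4 : ℝ) + 1) *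
        (∫ y' : EuclideanSpace ℝ (Fin 2), curl (velocity (fun _ => l * R.A k)
          (fun t y => exp (l * R.A k * t / 2) •
            v ((exp (l * R.A k * t) - 1) / (l * R.A k)) (exp (l * R.A k * t / 2) • y))
          (fun t y => exp (-(l * R.A k * t)) •
            w ((exp (l * R.A k * t) - 1) / (l * R.A k)) (exp (l * R.A k * t / 2) • y)) 0)
          (embedXY y' + z₀ • eZ) 2) * (63 / 50 * Real.sqrt (l * R.A k)) :=
        mul_le_mul_of_nonneg_left hsq (mul_nonneg hK0 hΓ0)
    _ = _ := by ring

/-- **THE CHILD'S PEAK AXIAL VORTICITY CEILING, FOR ANY PROFILE, UNIFORM IN TIME** (v2; `ν = 1`,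
host strain `λA_k`; the setting of `_childSwirl_le_of_circulation_anyProfile`): for a co-signed
child with cross-section circulation `Γ`, at every later time `t > 0` of `S` and every `x ∈ ℝ³`,
**`0 ≤ ω_z(t, x) ≤ 8 C_GNS · Γ · λA_k/(1 − e^{−λA_k t})`** — the planar `L^∞` smoothing bound
`‖ω̃(T)‖_∞ ≤ 8 C_GNS Γ/T` (the full Nash–Moser iteration, `PlanarVorticityLpDecay` §6) read through
Saffman (29) (`Lundgren.curl_lundgren_const_le_of_circulation`). NO dependence on the initial peak,
NO growth with the stretch (contrast `_childPeak_le_stretch_anyProfile`: `≤ e^{λA_k t}·B`); the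
CEILING companion of `_childPeak_floor_of_budget_anyProfile` (`sup ω_z ≥ Γ·λA_k/(8πρ)` after the
N-2′ budget): the child's peak is two-sidedly pinned at the Burgers scale `Γ·λA_k`
(Burgers' own peak: `Γ·λA_k/(4π)`). -/
theorem palasekTowerBreakdown_childPeak_le_of_circulation_anyProfile (R : TowerRates) (k : ℕ)
    {l : ℝ} (hl : 0 < l) (hS' : Convex ℝ S') (hv : IsClassicalNSSolutionOn S' 1 0 v q)
    (hω : HasUniformRapidDecayOn S' (fun σ η => PlanarEigenmode.vorticity (v σ) η))
    (hBS : ∀ σ ∈ S', ∀ η, v σ η = biotSavart2D (PlanarEigenmode.vorticity (v σ)) η)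
    (hw : IsSmoothSpaceTimeOn S' w)
    (hmaps : MapsTo (fun t => (exp (l * R.A k * t) - 1) / (l * R.A k)) S S') (h0 : (0 : ℝ) ∈ S)
    {t : ℝ} (ht : t ∈ S) (ht0 : 0 < t) (z₀ : ℝ)
    (hpos : ∀ x : EuclideanSpace ℝ (Fin 3), 0 ≤ curl (velocity (fun _ => l * R.A k)
          (fun t y => exp (l * R.A k * t / 2) •
            v ((exp (l * R.A k * t) - 1) / (l * R.A k)) (exp (l * R.A k * t / 2) • y))
          (fun t y => exp (-(l * R.A k * t)) •
            w ((exp (l * R.A k * t) - 1) / (l * R.A k)) (exp (l * R.A k * t / 2) • y)) 0) x 2)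
    (x : EuclideanSpace ℝ (Fin 3)) :
    0 ≤ curl (velocity (fun _ => l * R.A k)
          (fun t y => exp (l * R.A k * t / 2) •
            v ((exp (l * R.A k * t) - 1) / (l * R.A k)) (exp (l * R.A k * t / 2) • y))
          (fun t y => exp (-(l * R.A k * t)) •
            w ((exp (l * R.A k * t) - 1) / (l * R.A k)) (exp (l * R.A k * t / 2) • y)) t) x 2 ∧
      curl (velocity (fun _ => l * R.A k)
          (fun t y => exp (l * R.A k * t / 2) •
            v ((exp (l * R.A k * t) - 1) / (l * R.A k)) (exp (l * R.A k * t / 2) • y))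
          (fun t y => exp (-(l * R.A k * t)) •
            w ((exp (l * R.A k * t) - 1) / (l * R.A k)) (exp (l * R.A k * t / 2) • y)) t) x 2 ≤
        8 * (lintegralPowLePowLIntegralFDerivConst
          (volume : Measure (EuclideanSpace ℝ (Fin 2))) 2 : ℝ) *
          (∫ y' : EuclideanSpace ℝ (Fin 2), curl (velocity (fun _ => l * R.A k)
            (fun t y => exp (l * R.A k * t / 2) •
              v ((exp (l * R.A k * t) - 1) / (l * R.A k)) (exp (l * R.A k * t / 2) • y))
            (fun t y => exp (-(l * R.A k * t)) •
              w ((exp (l * R.A k * t) - 1) / (l * R.A k)) (exp (l * R.A k * t / 2) • y)) 0)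
            (embedXY y' + z₀ • eZ) 2) *
          (l * R.A k / (1 - exp (-(l * R.A k * t)))) := by
  have hγ : 0 < l * R.A k := mul_pos hl (R.A_pos k)
  have h := curl_lundgren_const_le_of_circulation hγ hS' one_pos hv hω hBS hw hmaps h0 ht ht0 hpos z₀ x
  simpa only [one_mul, sub_zero] using h

/-- **AFTER ONE STRAIN TIME THE PEAK CEILING IS `8·(63/50)²·C_GNS·Γ·λA_k`** (v2; `ν = 1`; setting
of `_childPeak_le_of_circulation_anyProfile`): for `λA_k t ≥ 1` and every `x`,
`ω_z(t, x) ≤ 8 (63/50)² C_GNS Γ λA_k` (`(1 − e^{−1})⁻¹ ≤ (63/50)²`) — the Burgers peak scale `Γ·λA_k`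
up to `12.7008·C_GNS`, whatever the profile; companion of the floor `Γ·λA_k/(8πρ)` after the
N-2′ budget (`_childPeak_floor_of_budget_anyProfile`). -/
theorem palasekTowerBreakdown_childPeak_le_after_one_strain_time_anyProfile (R : TowerRates)
    (k : ℕ) {l : ℝ} (hl : 0 < l) (hS' : Convex ℝ S') (hv : IsClassicalNSSolutionOn S' 1 0 v q)
    (hω : HasUniformRapidDecayOn S' (fun σ η => PlanarEigenmode.vorticity (v σ) η))
    (hBS : ∀ σ ∈ S', ∀ η, v σ η = biotSavart2D (PlanarEigenmode.vorticity (v σ)) η)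
    (hw : IsSmoothSpaceTimeOn S' w)
    (hmaps : MapsTo (fun t => (exp (l * R.A k * t) - 1) / (l * R.A k)) S S') (h0 : (0 : ℝ) ∈ S)
    {t : ℝ} (ht : t ∈ S) (hstrain : 1 ≤ l * R.A k * t) (z₀ : ℝ)
    (hpos : ∀ x : EuclideanSpace ℝ (Fin 3), 0 ≤ curl (velocity (fun _ => l * R.A k)
          (fun t y => exp (l * R.A k * t / 2) •
            v ((exp (l * R.A k * t) - 1) / (l * R.A k)) (exp (l * R.A k * t / 2) • y))
          (fun t y => exp (-(l * R.A k * t)) •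
            w ((exp (l * R.A k * t) - 1) / (l * R.A k)) (exp (l * R.A k * t / 2) • y)) 0) x 2)
    (x : EuclideanSpace ℝ (Fin 3)) :
    curl (velocity (fun _ => l * R.A k)
        (fun t y => exp (l * R.A k * t / 2) •
          v ((exp (l * R.A k * t) - 1) / (l * R.A k)) (exp (l * R.A k * t / 2) • y))
        (fun t y => exp (-(l * R.A k * t)) •
          w ((exp (l * R.A k * t) - 1) / (l * R.A k)) (exp (l * R.A k * t / 2) • y)) t) x 2 ≤
      8 * (63 / 50) ^ 2 * (lintegralPowLePowLIntegralFDerivConst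
          (volume : Measure (EuclideanSpace ℝ (Fin 2))) 2 : ℝ) *
        (∫ y' : EuclideanSpace ℝ (Fin 2), curl (velocity (fun _ => l * R.A k)
          (fun t y => exp (l * R.A k * t / 2) •
            v ((exp (l * R.A k * t) - 1) / (l * R.A k)) (exp (l * R.A k * t / 2) • y))
          (fun t y => exp (-(l * R.A k * t)) •
            w ((exp (l * R.A k * t) - 1) / (l * R.A k)) (exp (l * R.A k * t / 2) • y)) 0)
          (embedXY y' + z₀ • eZ) 2) *
        (l * R.A k) := by
  have hγ : 0 < l * R.A k := mul_pos hl (R.A_pos k)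
  have ht0 : 0 < t := by
    by_contra hle
    have : l * R.A k * t ≤ 0 := mul_nonpos_of_nonneg_of_nonpos hγ.le (not_lt.1 hle)
    linarith
  have h := palasekTowerBreakdown_childPeak_le_of_circulation_anyProfile R k hl hS' hv hω hBS hw hmaps
    h0 ht ht0 z₀ hpos x
  refine h.2.trans ?_
  have hΓ0 : 0 ≤ ∫ y' : EuclideanSpace ℝ (Fin 2), curl (velocity (fun _ => l * R.A k)
          (fun t y => exp (l * R.A k * t / 2) •
            v ((exp (l * R.A k * t) - 1) / (l * R.A k)) (exp (l * R.A k * t / 2) • y))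
          (fun t y => exp (-(l * R.A k * t)) •
            w ((exp (l * R.A k * t) - 1) / (l * R.A k)) (exp (l * R.A k * t / 2) • y)) 0)
          (embedXY y' + z₀ • eZ) 2 := integral_nonneg fun y' => hpos _
  have hC0 : 0 ≤ (lintegralPowLePowLIntegralFDerivConst
      (volume : Measure (EuclideanSpace ℝ (Fin 2))) 2 : ℝ) := NNReal.coe_nonneg _
  have hpos1 : 0 < 1 - exp (-(l * R.A k * t)) := by
    have : exp (-(l * R.A k * t)) < 1 := exp_lt_one_iff.2 (by linarith)
    linarith
  have hfrac : l * R.A k / (1 - exp (-(l * R.A k * t))) ≤ (63 / 50) ^ 2 * (l * R.A k) := by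
    rw [div_eq_mul_inv, mul_comm ((63 / 50 : ℝ) ^ 2)]
    exact mul_le_mul_of_nonneg_left (inv_one_sub_exp_neg_le hstrain) hγ.le
  calc _ ≤ 8 * (lintegralPowLePowLIntegralFDerivConst
          (volume : Measure (EuclideanSpace ℝ (Fin 2))) 2 : ℝ) *
          (∫ y' : EuclideanSpace ℝ (Fin 2), curl (velocity (fun _ => l * R.A k)
            (fun t y => exp (l * R.A k * t / 2) •
              v ((exp (l * R.A k * t) - 1) / (l * R.A k)) (exp (l * R.A k * t / 2) • y))
            (fun t y => exp (-(l * R.A k * t)) •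
              w ((exp (l * R.A k * t) - 1) / (l * R.A k)) (exp (l * R.A k * t / 2) • y)) 0)
            (embedXY y' + z₀ • eZ) 2) * ((63 / 50) ^ 2 * (l * R.A k)) :=
        mul_le_mul_of_nonneg_left hfrac (by positivity)
    _ = _ := by ring

end Summit.NavierStokesRegularity.FluidComputer.PalasekTowerClayBridge
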